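import Summits.KontsevichZagierPeriods.Zeta5Search.LaiSweepShard

/-!
# `κ₃` sweep certificate — shard file 020 of 127 (shards 140–146 of 889)

HONEST FRAMING. Systematic search; no irrationality claim unless certified. This file only checks,
by `decide +kernel`, shards 140–146 of the order-cell sweep of the `κ₃` point `(74, 2180, 444; δ74)`
(engine `LaiSweepEngine`, soundness `LaiSweepJump/Free/Eval/Shard/Kappa3`; a shard is `⟨regime, n,
p, q, p', q', Lo, Up⟩`: `n` cells from `p/q` to `p'/q'` with integer rate sums in `[Lo, Up]`, `K =
128`, `D = 2^40`). It draws NO conclusion: only the capstone `LaiKappa3SweepCert`, which needs all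
127 shard files, does. Kernel cost of this file ≈ 560 cells × 0.3 s.
-/

namespace Summit.KontsevichZagierPeriods.Zeta5Search.Sweep

set_option maxHeartbeats 100000000 in
/-- Shard 140: 80 cells of regime B from `19/328` to `17/287`.
[cite: Lai2024BallRivoal, §4 Lemma 4.3] -/
theorem shard140 :
    Shard.check 128 (2^40)
      ⟨true, 80, 19, 328, 17, 287, 120137872592909, 120407449301142⟩ = true := by
  decide +kernel

set_option maxHeartbeats 100000000 in
/-- Shard 141: 80 cells of regime B from `17/287` to `24/397`.
[cite: Lai2024BallRivoal, §4 Lemma 4.3] -/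
theorem shard141 :
    Shard.check 128 (2^40)
      ⟨true, 80, 17, 287, 24, 397, 109523285047336, 109754149557884⟩ = true := by
  decide +kernel

set_option maxHeartbeats 100000000 in
/-- Shard 142: 80 cells of regime B from `24/397` to `26/421`.
[cite: Lai2024BallRivoal, §4 Lemma 4.3] -/
theorem shard142 :
    Shard.check 128 (2^40)
      ⟨true, 80, 24, 397, 26, 421, 114045847000504, 114300819726195⟩ = true := by
  decide +kernel

set_option maxHeartbeats 100000000 in
/-- Shard 143: 80 cells of regime B from `26/421` to `23/365`.
[cite: Lai2024BallRivoal, §4 Lemma 4.3] -/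
theorem shard143 :
    Shard.check 128 (2^40)
      ⟨true, 80, 26, 421, 23, 365, 107662932562463, 107935964863685⟩ = true := by
  decide +kernel

set_option maxHeartbeats 100000000 in
/-- Shard 144: 80 cells of regime B from `23/365` to `16/249`.
[cite: Lai2024BallRivoal, §4 Lemma 4.3] -/
theorem shard144 :
    Shard.check 128 (2^40)
      ⟨true, 80, 23, 365, 16, 249, 103849950429025, 104094663949087⟩ = true := by
  decide +kernel

set_option maxHeartbeats 100000000 in
/-- Shard 145: 80 cells of regime B from `16/249` to `19/290`.
[cite: Lai2024BallRivoal, §4 Lemma 4.3] -/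
theorem shard145 :
    Shard.check 128 (2^40)
      ⟨true, 80, 16, 249, 19, 290, 103979738162358, 104239973596773⟩ = true := by
  decide +kernel

set_option maxHeartbeats 100000000 in
/-- Shard 146: 80 cells of regime B from `19/290` to `23/344`.
[cite: Lai2024BallRivoal, §4 Lemma 4.3] -/
theorem shard146 :
    Shard.check 128 (2^40)
      ⟨true, 80, 19, 290, 23, 344, 107766450282008, 108070515126839⟩ = true := by
  decide +kernel

/-- The checked shards of this file, in order. [folklore] -/
def shards020 : List (CheckedShard 128 (2^40)) :=
  [⟨_, shard140⟩, ⟨_, shard141⟩, ⟨_, shard142⟩, ⟨_, shard143⟩, ⟨_, shard144⟩,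
    ⟨_, shard145⟩, ⟨_, shard146⟩]

end Summit.KontsevichZagierPeriods.Zeta5Search.Sweep
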